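import Summits.AtomisticToContinuum.HydrodynamicLimit.Theorems.AnnealedZeroHorizonMeanFluxClosureCollisionEnergyExchangeMeanBound
import HarnessLib

/-!
# Stub FLUX-RS `stub_relSpeedCollisionMeanBound` of crux `MeanFluxClosure`
# (stmt-AtomisticToContinuum-9256, route AnnealedZeroHorizon, line `registered`, skeleton r7) — part A:
# the stub's functional verbatim at constant profiles, and its integrability for general profiles

The stub FLUX-RS is the relative-speed twin of stub FLUX (`stub_collisionEnergyExchangeMeanBound`): with
`RS(z) = Σ_{t_c ∈ (t₁,t₂]} Σ_{(i,j) colliding} ‖vᵢ⁻ − vⱼ⁻‖` the windowed RELATIVE-SPEED collision functional of the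
hard-sphere flow (Literature `HardSphereFlow.collisionalTransferFunctional` of the time-`t₁` point over `(0, t₂ − t₁]`
with the kernel `(i, j, z⁻, z⁺) ↦ ‖vᵢ⁻ − vⱼ⁻‖`, the pre-collisional relative speed of the ordered colliding pair), it
asks that `Q = σ_N (N+1)⁻¹ RS` be integrable with `E Q ≤ C` eventually in `N` under the TRUE (non-stationary) local
Gibbs law `localGibbsLaw σ a₀ u₀ θ₀ N (Φ N)`. It dominates the collisional momentum transfer and its contact (Taylor)
remainder (stubs CS / VIRIAL of the skeleton).

The FLUX support file `…CollisionEnergyExchangeMeanBound` already treats the relative-speed kernel at the level of the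
bare functional (`relSpeedFunctional_flow_const`, `integrable_relSpeedFunctional_flow`: flow invariance of the
homogeneous Gibbs law + the Cercignani–Illner–Pulvirenti one-window inequality `mmr_collisionFlux_const`; domination
`localGibbsMeasure σ a₀ u₀ θ₀ N ≤ Λ^{N+1} • localGibbsMeasure σ 1 0 θ₁ N` for general profiles). Here, with `Q` the stub's
functional VERBATIM (prefactor `σ_N (N+1)⁻¹` included, flow family `Φ : (N : ℕ) → …`):

* `relSpeedCollision_const`, `stub_relSpeedCollisionMeanBound_const` — the registered stub HOLDS at constant profiles
  `a₀ ≡ a`, `θ₀ ≡ θ`, `u₀ ≡ u` (`σ₀ = 1/2`, `C = 80 σ³ (3θ + ‖u‖²) (t₂ − t₁)`, EVERY `N`);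
* `integrable_relSpeedCollision` — for general continuous positive profiles the INTEGRABILITY half of the stub holds at
  every `N` (`0 < σ ≤ 1/2`).

The MEAN half out of equilibrium is the open two-particle contact statistic of FLUX; part B reduces it to the crux item
`Theses.BGEndpointRigidity.LanfordEnvelopeR` exactly as for the energy mark.

References: C. Cercignani, R. Illner, M. Pulvirenti, *The Mathematical Theory of Dilute Gases* (1994) App. 4.A;
H. Spohn, *Large Scale Dynamics of Interacting Particles* (1991) Part I §2.3.
-/

noncomputable section

namespace Summit.AtomisticToContinuum.HydrodynamicLimit.Theorems

open scoped BigOperators ENNReal Topology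
open MeasureTheory Set Filter
open Literature.MathematicalPhysics.KineticTheory Literature.Analysis.FluidPDE Literature.Analysis.FunctionSpaces
open Summit.AtomisticToContinuum.HydrodynamicLimit.Theorems.CollisionEnergyExchangeMeanBound

namespace RelSpeedCollisionMeanBound

/-! ## The stub's functional `Q` verbatim at constant profiles -/

/-- **Constant profiles, verbatim form.** For constant profiles `a, θ > 0`, `u`, every `0 < σ ≤ 1/2`, every flow family,
all `0 ≤ t₁ ≤ t₂` and EVERY `N`: the stub's functional `Q = σ_N (N+1)⁻¹ RS(Φ_{t₁} z; (0, t₂ − t₁])` is integrable under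
`G_N = localGibbsLaw σ a u θ N (Φ N)` with `E Q ≤ 80 σ³ (3θ + ‖u‖²) (t₂ − t₁)` (`relSpeedFunctional_flow_const`). [folklore] -/
theorem relSpeedCollision_const {σ : ℝ} (hσ : 0 < σ) (hσ2 : σ ≤ 1 / 2) {a θ : ℝ} (u : V3) (ha : 0 < a) (hθ : 0 < θ)
    (Φ : (N : ℕ) → HardSphereFlow (Torus.geometry (Fin 3)) (hsDiameter σ N) (N + 1)) {t₁ t₂ : ℝ} (h₁ : 0 ≤ t₁)
    (h₁₂ : t₁ ≤ t₂) (N : ℕ) :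
    ∀ Q : Config (N + 1) (Fin 3) T3 → ℝ, Q = (fun z => hsDiameter σ N * ((N + 1 : ℕ) : ℝ)⁻¹ *
      (Φ N).collisionalTransferFunctional (fun (i j : Fin (N + 1)) (pre _post : Config (N + 1) (Fin 3) T3) =>
        ‖(pre i).2 - (pre j).2‖) ((Φ N).flow t₁ z) (t₂ - t₁)) →
      Integrable Q (localGibbsLaw σ (fun _ => a) (fun _ => u) (fun _ => θ) N (Φ N)) ∧
        ∫ z, Q z ∂(localGibbsLaw σ (fun _ => a) (fun _ => u) (fun _ => θ) N (Φ N)) ≤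
          80 * σ ^ 3 * (3 * θ + ‖u‖ ^ 2) * (t₂ - t₁) := by
  intro Q hQ
  obtain ⟨hI, hmean⟩ := relSpeedFunctional_flow_const hσ hσ2 u ha hθ (Φ N) h₁ h₁₂
  subst hQ
  rw [← integral_const_mul] at hmean
  exact ⟨hI.const_mul _, hmean⟩

end RelSpeedCollisionMeanBound

open RelSpeedCollisionMeanBound in
/-- **The registered stub `stub_relSpeedCollisionMeanBound` HOLDS at constant profiles** (its exact quantifier shape with
`a₀ := fun _ => a`, `θ₀ := fun _ => θ`, `u₀ := fun _ => u`, `0 < a`, `0 < θ`; `σ₀ = 1/2`, `C = 80 σ³ (3θ + ‖u‖²) (t₂ − t₁)`,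
all `N`). [folklore] -/
theorem stub_relSpeedCollisionMeanBound_const : ∀ (a θ : ℝ) (u : Literature.MathematicalPhysics.KineticTheory.V3), 0 < a → 0 < θ → ∃ σ₀ : ℝ, 0 < σ₀ ∧ ∀ σ : ℝ, 0 < σ → σ < σ₀ → ∀ Φ : (N : ℕ) → Literature.Analysis.FluidPDE.HardSphereFlow (Literature.Analysis.FluidPDE.Torus.geometry (Fin 3)) (Literature.MathematicalPhysics.KineticTheory.hsDiameter σ N) (N + 1), ∀ t₁ t₂ : ℝ, 0 ≤ t₁ → t₁ ≤ t₂ → ∃ C : ℝ, ∀ᶠ N in Filter.atTop, ∀ Q : Literature.Analysis.FluidPDE.Config (N + 1) (Fin 3) Literature.MathematicalPhysics.KineticTheory.T3 → ℝ, Q = (fun z => Literature.MathematicalPhysics.KineticTheory.hsDiameter σ N * ((N + 1 : ℕ) : ℝ)⁻¹ * (Φ N).collisionalTransferFunctional (fun (i j : Fin (N + 1)) (pre _post : Literature.Analysis.FluidPDE.Config (N + 1) (Fin 3) Literature.MathematicalPhysics.KineticTheory.T3) => ‖(pre i).2 - (pre j).2‖) ((Φ N).flow t₁ z) (t₂ -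 t₁)) → MeasureTheory.Integrable Q (Literature.MathematicalPhysics.KineticTheory.localGibbsLaw σ (fun _ => a) (fun _ => u) (fun _ => θ) N (Φ N)) ∧ ∫ z, Q z ∂Literature.MathematicalPhysics.KineticTheory.localGibbsLaw σ (fun _ => a) (fun _ => u) (fun _ => θ) N (Φ N) ≤ C :=
  fun _a _θ u ha hθ => ⟨1 / 2, by norm_num, fun _σ hσ hσ2 Φ _t₁ _t₂ h₁ h₁₂ =>
    ⟨_, Eventually.of_forall fun N => relSpeedCollision_const hσ hσ2.le u ha hθ Φ h₁ h₁₂ N⟩⟩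

/-- **Integrability half of the registered stub `stub_relSpeedCollisionMeanBound`, general profiles, EVERY `N`**: for
continuous `a₀, θ₀ > 0`, `u₀`, `0 < σ ≤ 1/2`, every flow family, `0 ≤ t₁ ≤ t₂` and every `N`, the stub's functional
`Q = σ_N (N+1)⁻¹ RS(Φ_{t₁} z; (0, t₂ − t₁])` is integrable under `localGibbsLaw σ a₀ u₀ θ₀ N (Φ N)`
(`integrable_relSpeedFunctional_flow`: domination by a homogeneous Gibbs law). [folklore] -/
theorem integrable_relSpeedCollision : ∀ {a₀ θ₀ : Literature.MathematicalPhysics.KineticTheory.T3 → ℝ} {u₀ : Literature.MathematicalPhysics.KineticTheory.T3 → Literature.MathematicalPhysics.KineticTheory.V3}, Continuous a₀ → Continuous θ₀ → Continuous u₀ → (∀ x, 0 < a₀ x) → (∀ x, 0 < θ₀ x) → ∀ {σ : ℝ}, 0 < σ → σ ≤ 1 / 2 → ∀ (Φ : (N : ℕ) → Literature.Analysis.FluidPDE.HardSphereFlow (Literature.Analysis.FluidPDE.Torus.geometry (Fin 3)) (Literature.MathematicalPhysics.KineticTheory.hsDiameter σ N) (N + 1)) {t₁ t₂ : ℝ},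 0 ≤ t₁ → t₁ ≤ t₂ → ∀ (N : ℕ) (Q : Literature.Analysis.FluidPDE.Config (N + 1) (Fin 3) Literature.MathematicalPhysics.KineticTheory.T3 → ℝ), Q = (fun z => Literature.MathematicalPhysics.KineticTheory.hsDiameter σ N * ((N + 1 : ℕ) : ℝ)⁻¹ * (Φ N).collisionalTransferFunctional (fun (i j : Fin (N + 1)) (pre _post : Literature.Analysis.FluidPDE.Config (N + 1) (Fin 3) Literature.MathematicalPhysics.KineticTheory.T3) => ‖(pre i).2 - (pre j).2‖) ((Φ N).flow t₁ z) (t₂ - t₁)) → MeasureTheory.Integrable Q (Literature.MathematicalPhysics.KineticTheory.localGibbsLaw σ a₀ u₀ θ₀ N (Φ N)) := by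
  intro a₀ θ₀ u₀ ha hθ hu ha0 hθ0 σ hσ hσ2 Φ t₁ t₂ h₁ h₁₂ N Q hQ
  subst hQ
  exact (integrable_relSpeedFunctional_flow ha hθ hu ha0 hθ0 hσ hσ2 (Φ N) h₁ h₁₂).const_mul _

end Summit.AtomisticToContinuum.HydrodynamicLimit.Theorems

end
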